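import Literature.MathematicalPhysics.QuantumFieldTheory.ConformalBootstrap3D.PointKernelK34v2Data
import Literature.MathematicalPhysics.QuantumFieldTheory.ConformalBootstrap3D.PointKernelParts

/-!
# K34v2 certificate, kernel part file P72: one-cell head segments 185, 186, 187 in level ranges

The head cells whose kernel evaluation exceeds one `decide` are one-cell segments of `hsegsK34v2`; each is
checked by `PCert.hPartSideOK` (side conditions) and `PCert.hPartOK` per level range `[n_lo, n_lo + count)`
against an integer claim, the claims summing to `≥ 0` (`PointKernel.partsOK`); soundness is
`PCert.hParts_sound` (`PointKernelParts`).  The part files `P1, P2, …` are mutually independent (each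
imports only the data file); the ranges of one cell may span several of them, and the per-cell
conclusions `hparts_i` / `hcell_i` of those cells are assembled in `PointKernelK34v2.lean`.
Estimated kernel time 257 s.
-/

set_option maxRecDepth 100000
set_option maxHeartbeats 0

namespace Literature.MathematicalPhysics.QuantumFieldTheory.ConformalBootstrap3D.PointKernelK34v2

open Literature.MathematicalPhysics.QuantumFieldTheory.ConformalBootstrap3D.PointKernel

/-- levels `[31, 44)` of segment 185: partial lower sum `≥` claim. [folklore] -/
theorem part_185_1 : certK34v2.hPartOK (PCert.segAt hsegsK34v2 185) JHK34v2 31 13 (13181285804154641026587294522285656479) = true := by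
  decide +kernel

/-- levels `[44, 49)` of segment 185: partial lower sum `≥` claim. [folklore] -/
theorem part_185_2 : certK34v2.hPartOK (PCert.segAt hsegsK34v2 185) JHK34v2 44 5 (1064203959674873063625169846648541220) = true := by
  decide +kernel

/-- one-cell segment 186 (row 6, cell `[57/8, 457/64]`, chord, `n_F = 40`,
2 level ranges): side conditions. [folklore] -/
theorem pside_186 : certK34v2.hPartSideOK (PCert.segAt hsegsK34v2 186) JHK34v2 = true := by
  decide +kernel

/-- its level ranges `(n_lo, count, claim)`. [folklore] -/
def parts_186 : List (ℕ × ℕ × ℤ) := [(0, 32, -8964958677004092175138339187349798504), (32, 9, 8964958677004092175138339187349798504)]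

/-- the ranges tile `[0, n_F]` and the claims sum to `≥ 0`. [folklore] -/
theorem pcov_186 : PointKernel.partsOK 40 parts_186 = true := by
  decide +kernel

/-- levels `[0, 32)` of segment 186: partial lower sum `≥` claim. [folklore] -/
theorem part_186_0 : certK34v2.hPartOK (PCert.segAt hsegsK34v2 186) JHK34v2 0 32 (-8964958677004092175138339187349798504) = true := by
  decide +kernel

/-- levels `[32, 41)` of segment 186: partial lower sum `≥` claim. [folklore] -/
theorem part_186_1 : certK34v2.hPartOK (PCert.segAt hsegsK34v2 186) JHK34v2 32 9 (8964958677004092175138339187349798504) = true := by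
  decide +kernel

/-- one-cell segment 187 (row 6, cell `[457/64, 229/32]`, chord, `n_F = 40`,
2 level ranges): side conditions. [folklore] -/
theorem pside_187 : certK34v2.hPartSideOK (PCert.segAt hsegsK34v2 187) JHK34v2 = true := by
  decide +kernel

/-- its level ranges `(n_lo, count, claim)`. [folklore] -/
def parts_187 : List (ℕ × ℕ × ℤ) := [(0, 32, -6905221558440544439122679278747895242), (32, 9, 6905221558440544439122679278747895243)]

/-- the ranges tile `[0, n_F]` and the claims sum to `≥ 0`. [folklore] -/
theorem pcov_187 : PointKernel.partsOK 40 parts_187 = true := by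
  decide +kernel

/-- levels `[0, 32)` of segment 187: partial lower sum `≥` claim. [folklore] -/
theorem part_187_0 : certK34v2.hPartOK (PCert.segAt hsegsK34v2 187) JHK34v2 0 32 (-6905221558440544439122679278747895242) = true := by
  decide +kernel

end Literature.MathematicalPhysics.QuantumFieldTheory.ConformalBootstrap3D.PointKernelK34v2
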